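import Literature.Probability.LatticeModels.CrossingUniquenessPrelim
import Literature.Probability.LatticeModels.BackboneChainRule
import HarnessLib

/-!
# Uniqueness of the crossing clusters: `{𝓜 ≠ ∅} ∖ I_k ⊆ F₁ ∪ F₂ ∪ F₃ ∪ F₄` (Aizenman–Duminil-Copin 2021, proof of Lemma 4.4 / 6.2)

Topic `Literature/Probability/LatticeModels`. The second half of the proof of the intersection property,

* M. Aizenman, H. Duminil-Copin, *Marginal triviality of the scaling limits of critical 4D Ising and
  `φ⁴₄` models*, Ann. of Math. **194** (2021), arXiv:1912.07973 [AizenmanDuminilCopinAnnals2021],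
  proof of **Lemma 4.4** (p. 12; "the same proof" for Lemma 6.2, p. 21): "to conclude the argument we
  need to establish the uniqueness, with large probability, of the crossing cluster in `n₁+n₃` … If the
  event `{𝓜 ≠ ∅}` occurs but not `I_k`, then one of the following four events must occur:
  `F₁` := the backbone `Γ(n₁)` of `n₁` does two successive crossings of `Ann(ℓ_k, n)`;
  `F₂` := `n₁+n₃` contains a cluster crossing `Ann(n,m) ∖ Γ(n₁)`;
  `F₃` := `n₁+n₃` contains a cluster crossing `Ann(M,N) ∖ Γ(n₁)`;
  `F₄` := the backbone `Γ(n₁)` of `n₁` does two successive crossings of `Ann(N, ℓ_{k+1})`",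

is a deterministic statement about one pair `(n₁, n₃)` of currents (and its twin for `(n₂, n₄)`), which
this file proves on a finite simple graph whose vertex type carries a pseudo-metric with integer
distances to the centre `u` changing by at most one along edges (`AnnulusCrossing.lean`), for radii
`a < n₀ ≤ m₀ ≤ M₀ ≤ N₀ < b` (`a = ℓ_k`, `b = ℓ_{k+1}`), the annulus `W = {a ≤ dist(u,·) ≤ b}`, a current
`n₁` with `∂n₁ = {u} Δ {y}`, `dist(u,y) > b`, its backbone `Γ = explore rk n₁ {y} u`
(`CurrentExploration.lean`), any current `n₃`, and `m = n₁ + n₃`: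

* the four events, read deterministically: `Current.FOne`, `Current.FFour` (the walk is at distance
  `≥ n₀`, resp. `≥ b`, and later at distance `≤ a`, resp. `≤ N₀` — zigzags through the spheres,
  `zigzag_spheres_of_return` of `CrossingUniquenessPrelim.lean`, the form bounded by the two-passage
  chain rule), and `Current.FBand … p q` for `F₂` (`(p,q) = (n₀,m₀)`) and `F₃` (`(p,q) = (M₀,N₀)`): two
  vertices on the spheres of radii `p`, `q` joined by open edges of `m` **avoiding the sites of `Γ`** —
  `Current.avoidGraph`; such paths are paths of `(n₁ off Γ) + n₃` through the depleted graph
  (`Current.connIn_of_avoidGraph_reachable`, the event bounded in `DepletedPairConnection.lean`);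
* `Current.crossAt_backbone` — the canonical crossing cluster `C*` of `m` in `W` carried by the backbone
  (from its last visit of the inner sphere before first reaching the outer sphere), and, under
  `¬F₁ ∧ ¬F₄`, every site of `Γ` at distance in `[n₀, N₀]` lies in `C*`;
* `Current.cluster_eq_canonical_of_not_F` — **uniqueness**: under `¬F₁ ∧ ¬F₂ ∧ ¬F₄` every crossing
  cluster of `m` in `W` is `C*` (a second one would cross the band `[n₀, m₀]` inside `W` away from `C*`,
  hence off `Γ`: `F₂`);
* `Current.mem_canonical_of_not_F` — under `¬F₂ ∧ ¬F₃` (and the conclusion of `crossAt_backbone`), every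
  `x₀ ∈ C_m(u)` with `m₀ ≤ dist(u,x₀) ≤ M₀` lies in `C*` (its component in the band `[n₀, N₀]` reaches the
  sphere `n₀` or `N₀`; away from `C*` this is `F₂` or `F₃`);
* `Current.ikEvent_of_not_F` — **the implication**: if neither `F₁,…,F₄` for `(n₁,n₃)` nor their twins
  for `(n₂,n₄)` occur and `𝓜 = C_m(u) ∩ C_{m'}(u) ∩ {m₀ ≤ dist ≤ M₀} ≠ ∅`, then `I_k`
  (`Current.IkEvent W a b u m m'` of `AnnulusCrossing.lean`).

Everything is proved; no named fact is introduced.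

## References

* M. Aizenman, H. Duminil-Copin, Ann. of Math. 194 (2021), arXiv:1912.07973, §4.2, proof of Lemma 4.4
  (events `F₁`–`F₄` and "If the event `{𝓜 ≠ ∅}` occurs but not `I_k` …", p. 12; Fig. 3); §6.1, proof of
  Lemma 6.2 (p. 21) [AizenmanDuminilCopinAnnals2021].
-/

noncomputable section

open Finset
open scoped symmDiff

namespace Literature.Probability.LatticeModels

variable {V : Type*} [Fintype V] [DecidableEq V] {G : SimpleGraph V} [DecidableRel G.Adj]

namespace Current

variable {rk : G.edgeFinset → ℕ}

/-! ### The walk moves along open edges of the current -/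

/-- **Consecutive sites of the walk are equal or joined by an open edge of `n`** (a move traverses a
bond of odd, hence positive, current). [folklore] -/
theorem pos_exploreAt_succ_eq_or_traced_adj {n : Current G} {Y : Finset V} (a : V) (k : ℕ) :
    (exploreAt rk n Y a (k + 1)).pos = (exploreAt rk n Y a k).pos ∨
      (Percolation.openGraph n.traced).Adj (exploreAt rk n Y a k).pos (exploreAt rk n Y a (k + 1)).pos := by
  rw [exploreAt_succ]
  set s := exploreAt rk n Y a k with hs
  rcases xstep_cases (rk := rk) (n := n) (Y := Y) s with ⟨-, h⟩ | ⟨-, -, h⟩ | ⟨-, -, hA, h⟩ | ⟨-, -, -, h⟩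
  · rw [h]; exact Or.inl rfl
  · rw [h]; exact Or.inl rfl
  · rw [h]
    set e := Function.argminOn rk (↑(availAt n s) : Set G.edgeFinset) hA with he
    have heA : s.pos ∈ (e : Sym2 V) := (mem_availAt.1 (argminOn_mem_availAt (rk := rk) hA)).1.1
    show (if Odd (n e) then otherEnd e s.pos else s.pos) = s.pos ∨
      (Percolation.openGraph n.traced).Adj s.pos (if Odd (n e) then otherEnd e s.pos else s.pos)
    split_ifs with hodd
    · right
      rw [Percolation.openGraph_adj]
      refine ⟨?_, (otherEnd_ne heA).symm⟩
      have hsp : s(s.pos, otherEnd e s.pos) = (e : Sym2 V) := otherEnd_spec heA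
      rw [hsp, mem_traced_iff]
      exact hodd.pos
    · exact Or.inl rfl
  · rw [h]; exact Or.inl rfl

/-- All sites of the walk from `a` lie in the cluster `C_n(a)`. [folklore] -/
theorem pos_exploreAt_mem_cluster {n : Current G} {Y : Finset V} (a : V) (k : ℕ) :
    (exploreAt rk n Y a k).pos ∈ n.cluster a := by
  induction k with
  | zero => rw [exploreAt_zero]; exact mem_cluster_self n a
  | succ k ih =>
    rcases pos_exploreAt_succ_eq_or_traced_adj (rk := rk) (n := n) (Y := Y) a k with h | h
    · rw [h]; exact ih
    · exact mem_cluster_of_adj ih h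

/-! ### The setting: centre, annulus, backbone, and the four events -/

section Setting

variable [PseudoMetricSpace V] {u : V}

/-- The graph of the **open edges of `m` avoiding the sites visited by the walk `Γ`** ("`ℤ⁴ ∖ Γ(n₁)`"):
adjacent iff joined by an open edge of `m` and both endpoints are unvisited. [cite: AizenmanDuminilCopinAnnals2021, arXiv:1912.07973 §4.2, proof of Lemma 4.4 (events F₂, F₃: "crossing Ann(n,m) ∖ Γ(n₁)") (p. 12)] -/
def avoidGraph (m : Current G) (vis : Finset V) : SimpleGraph V where
  Adj z z' := (Percolation.openGraph m.traced).Adj z z' ∧ z ∉ vis ∧ z' ∉ vis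
  symm := ⟨fun _ _ h => ⟨h.1.symm, h.2.2, h.2.1⟩⟩
  loopless := ⟨fun _ h => h.1.ne rfl⟩

/-- **`F₁`** (deterministic reading): the walk is at distance `≥ n₀` at some time and at distance `≤ a`
at some later time ("`Γ(n₁)` does two successive crossings of `Ann(ℓ_k, n)`"; by
`zigzag_spheres_of_return` this is a zigzag through the spheres of radii `n₀` and `a`).
[cite: AizenmanDuminilCopinAnnals2021, arXiv:1912.07973 §4.2, proof of Lemma 4.4 (event F₁) (p. 12)] -/
def FOne (rk : G.edgeFinset → ℕ) (n₁ : Current G) (y u : V) (n₀ a : ℕ) : Prop :=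
  ∃ t₁ t₂, t₁ ≤ t₂ ∧ (n₀ : ℝ) ≤ dist u (exploreAt rk n₁ {y} u t₁).pos ∧ dist u (exploreAt rk n₁ {y} u t₂).pos ≤ a

/-- **`F₄`**: the walk is at distance `≥ b` at some time and at distance `≤ N₀` later ("`Γ(n₁)` does two
successive crossings of `Ann(N, ℓ_{k+1})`"). [cite: AizenmanDuminilCopinAnnals2021, arXiv:1912.07973 §4.2, proof of Lemma 4.4 (event F₄) (p. 12)] -/
def FFour (rk : G.edgeFinset → ℕ) (n₁ : Current G) (y u : V) (b N₀ : ℕ) : Prop :=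
  ∃ t₁ t₂, t₁ ≤ t₂ ∧ (b : ℝ) ≤ dist u (exploreAt rk n₁ {y} u t₁).pos ∧ dist u (exploreAt rk n₁ {y} u t₂).pos ≤ N₀

/-- **`F₂` / `F₃`** (with radii `(p, q) = (n₀, m₀)`, resp. `(M₀, N₀)`): a vertex at distance `p` and a
vertex at distance `q` are joined by open edges of `m = n₁ + n₃` avoiding the sites of `Γ(n₁)`
("`n₁+n₃` contains a cluster crossing `Ann(n,m) ∖ Γ(n₁)`"). [cite: AizenmanDuminilCopinAnnals2021, arXiv:1912.07973 §4.2, proof of Lemma 4.4 (events F₂, F₃) (p. 12)] -/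
def FBand (rk : G.edgeFinset → ℕ) (n₁ n₃ : Current G) (y u : V) (p q : ℕ) : Prop :=
  ∃ z z', dist u z = p ∧ dist u z' = q ∧ (avoidGraph (n₁ + n₃) (explore rk n₁ {y} u).vis).Reachable z z'

/-! ### Paths avoiding `Γ` are paths of the off part through the depleted graph -/

omit [PseudoMetricSpace V] in
/-- **An `avoidGraph`-path is a connection of `(n₁ off Γ) + n₃` through the depleted graph** `G` minus
the bonds used by `Γ` (the event of `DepletedPairConnection.lean`). [cite: AizenmanDuminilCopinAnnals2021, arXiv:1912.07973 §4.2, proof of Lemma 4.4 (bound on F₂) (p. 12)] -/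
theorem connIn_of_avoidGraph_reachable {n₁ : Current G} {y : V} (n₃ : Current G) {z z' : V}
    (h : (avoidGraph (n₁ + n₃) (explore rk n₁ {y} u).vis).Reachable z z') :
    onEdges (explore rk n₁ {y} u).usedᶜ n₁ + n₃ ∈
      connIn (G.deleteEdges ↑((explore rk n₁ {y} u).used.image fun e : G.edgeFinset => (e : Sym2 V))) z z' := by
  rw [mem_connIn_iff]
  refine h.mono ?_
  intro p q hpq
  obtain ⟨hadj, hp, hq⟩ := hpq
  have hadj' := adj_off_add_of_adj_of_avoid (rk := rk) (n := n₁) (Y := {y}) u n₃ hadj hp hq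
  rw [Percolation.openGraph_adj] at hadj' ⊢
  obtain ⟨⟨he, hpos⟩, hne⟩ := hadj'
  refine ⟨⟨?_, ⟨he, hpos⟩⟩, hne⟩
  -- the bond is not used, hence an edge of the depleted graph
  rw [SimpleGraph.edgeSet_deleteEdges, Set.mem_sdiff]
  refine ⟨SimpleGraph.mem_edgeFinset.1 he, ?_⟩
  rw [Finset.mem_coe, Finset.mem_image]
  rintro ⟨e', he', hee'⟩
  have hnot := not_mem_used_of_adj_of_avoid (rk := rk) (n := n₁) (Y := {y}) u he hp hq
  have : e' = ⟨s(p, q), he⟩ := Subtype.ext hee'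
  exact hnot (this ▸ he')

/-! ### The canonical crossing of the backbone and `Γ ∩ {n₀ ≤ dist ≤ N₀} ⊆ C*` -/

/-- **The canonical crossing of the annulus by the backbone, and the sites of `Γ` in the middle band.**
For `∂n₁ = {u} Δ {y}`, `dist(u,y) > b`, radii `a < n₀ ≤ N₀ < b`, `W = {a ≤ dist ≤ b}`: there is a time
`σ` at which the walk is at distance exactly `a` such that (i) `CrossAt W a b u (n₁ + n₃) (pos σ)` — the
cluster `C*` of `pos σ` in `(n₁+n₃)|_W` crosses `W` — and (ii) if neither `F₁` nor `F₄` occurs, every site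
of the walk at distance in `[n₀, N₀]` lies in `C*`. (`σ` is the last time at distance `≤ a` before the
first time `τ` at distance `≥ b`; the walk stays in `W` on `[σ, τ]`.) [cite: AizenmanDuminilCopinAnnals2021, arXiv:1912.07973 §4.2 (p. 11: "all the crossing clusters of n₁+n₃ belong to the n₁+n₃ cluster of the sources"; proof of Lemma 4.4, p. 12)] -/
theorem crossAt_backbone (hstep : ∀ v w, G.Adj v w → dist u w ≤ dist u v + 1) (hint : ∀ v, ∃ k : ℕ, dist u v = k)
    (hrk : Function.Injective rk) {n₁ : Current G} {y : V} (n₃ : Current G)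
    {a n₀ N₀ b : ℕ} (han : a < n₀) (hnN : n₀ ≤ N₀) (hNb : N₀ < b) (hs : n₁.sources = {u} ∆ {y})
    (hy : (b : ℝ) < dist u y) {W : Finset V} (hW : ∀ v, v ∈ W ↔ (a : ℝ) ≤ dist u v ∧ dist u v ≤ b) :
    ∃ σ : ℕ, dist u (exploreAt rk n₁ {y} u σ).pos = a ∧
      CrossAt W a b u (n₁ + n₃) (exploreAt rk n₁ {y} u σ).pos ∧
      (¬ FOne rk n₁ y u n₀ a → ¬ FFour rk n₁ y u b N₀ →
        ∀ t, (n₀ : ℝ) ≤ dist u (exploreAt rk n₁ {y} u t).pos → dist u (exploreAt rk n₁ {y} u t).pos ≤ N₀ →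
          (exploreAt rk n₁ {y} u t).pos ∈ (restrictTo W (n₁ + n₃)).cluster (exploreAt rk n₁ {y} u σ).pos) := by
  classical
  choose dn hdn using hint
  set pos : ℕ → V := fun t => (exploreAt rk n₁ {y} u t).pos with hpos_def
  have hd : ∀ t, dist u (pos t) = dn (pos t) := fun t => hdn _
  -- steps change `dn ∘ pos` by at most one
  have hst : ∀ t, dn (pos (t + 1)) ≤ dn (pos t) + 1 ∧ dn (pos t) ≤ dn (pos (t + 1)) + 1 := by
    intro t
    have h := dist_pos_exploreAt_succ (rk := rk) (n := n₁) (Y := {y}) hstep u t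
    simp only [hpos_def] at h ⊢
    rw [hdn, hdn] at h
    exact ⟨by exact_mod_cast h.1, by exact_mod_cast h.2⟩
  have hWn : ∀ v, v ∈ W ↔ a ≤ dn v ∧ dn v ≤ b := by
    intro v; rw [hW v, hdn]
    exact ⟨fun h => ⟨by exact_mod_cast h.1, by exact_mod_cast h.2⟩, fun h => ⟨by exact_mod_cast h.1, by exact_mod_cast h.2⟩⟩
  -- the walk ends at `y`, at distance `> b`
  set Nh := Fintype.card G.edgeFinset + 1 with hNh
  have hend : pos Nh = y := by
    simp only [hpos_def]
    rw [← explore_eq_exploreAt]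
    exact (explore_done_of_sources_eq hrk hs).2
  have hyn : b < dn y := by rw [hdn] at hy; exact_mod_cast hy
  -- `τ` = first time at distance `≥ b`; `σ` = last time `≤ τ` at distance `≤ a`
  have hexτ : ∃ t, b ≤ dn (pos t) := ⟨Nh, by rw [hend]; exact hyn.le⟩
  set τ := Nat.find hexτ with hτ
  have hτspec : b ≤ dn (pos τ) := Nat.find_spec hexτ
  have hτmin : ∀ j, j < τ → dn (pos j) < b := fun j hj => not_le.1 (Nat.find_min hexτ hj)
  have h0 : dn (pos 0) = 0 := by
    have : dist u (pos 0) = 0 := by simp only [hpos_def]; rw [exploreAt_zero]; exact dist_self u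
    rw [hd] at this; exact_mod_cast this
  have hτpos : 0 < τ := by
    by_contra h
    have hτ0 : τ = 0 := by omega
    rw [hτ0, h0] at hτspec
    omega
  have hτeq : dn (pos τ) = b := by
    have := (hst (τ - 1)).1
    rw [show τ - 1 + 1 = τ by omega] at this
    have := hτmin (τ - 1) (by omega)
    omega
  set σ := Nat.findGreatest (fun t => dn (pos t) ≤ a) τ with hσ
  have hσle : σ ≤ τ := Nat.findGreatest_le τ
  have hσspec : dn (pos σ) ≤ a := Nat.findGreatest_spec (P := fun t => dn (pos t) ≤ a) (Nat.zero_le τ) (by rw [h0]; exact Nat.zero_le a)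
  have hσmax : ∀ t, σ < t → t ≤ τ → a < dn (pos t) := by
    intro t h1 h2
    by_contra h
    have hle : t ≤ σ := by
      rw [hσ]
      exact Nat.le_findGreatest (P := fun t => dn (pos t) ≤ a) h2 (not_lt.1 h)
    omega
  have hσlt : σ < τ := by
    rcases lt_or_eq_of_le hσle with h | h
    · exact h
    · exfalso; rw [h, hτeq] at hσspec; omega
  have hσeq : dn (pos σ) = a := by
    have h1 := hσmax (σ + 1) (Nat.lt_succ_self σ) hσlt
    have h2 := (hst σ).1
    omega
  -- the walk stays in `W` on `[σ, τ]`, hence in the cluster of `pos σ` in `(n₁+n₃)|_W`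
  have hinW : ∀ t, σ ≤ t → t ≤ τ → pos t ∈ W := by
    intro t h1 h2
    rw [hWn]
    rcases lt_or_eq_of_le h1 with h1 | h1
    · refine ⟨(hσmax t h1 h2).le, ?_⟩
      rcases lt_or_eq_of_le h2 with h2 | h2
      · exact (hτmin t h2).le
      · rw [h2, hτeq]
    · rw [← h1, hσeq]; exact ⟨le_rfl, by omega⟩
  have hseg : ∀ t, σ ≤ t → t ≤ τ → pos t ∈ (restrictTo W (n₁ + n₃)).cluster (pos σ) := by
    intro t h1 h2
    induction t with
    | zero =>
      have : σ = 0 := by omega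
      rw [this]; exact mem_cluster_self _ _
    | succ t ih =>
      rcases lt_or_eq_of_le h1 with h1' | h1'
      · have ih' := ih (by omega) (by omega)
        rcases pos_exploreAt_succ_eq_or_traced_adj (rk := rk) (n := n₁) (Y := {y}) u t with h | h
        · simp only [hpos_def] at ih' ⊢; rw [h]; exact ih'
        · refine mem_cluster_of_adj ih' (adj_restrictTo_iff.2 ⟨?_, hinW t (by omega) (by omega), hinW (t + 1) h1 h2⟩)
          -- an open edge of `n₁` is an open edge of `n₁ + n₃`
          rw [Percolation.openGraph_adj] at h ⊢
          obtain ⟨⟨he, hp⟩, hne⟩ := h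
          exact ⟨⟨he, lt_of_lt_of_le hp (le_self_add : n₁ ⟨_, he⟩ ≤ (n₁ + n₃) ⟨_, he⟩)⟩, hne⟩
      · rw [← h1']; exact mem_cluster_self _ _
  refine ⟨σ, by rw [hd, hσeq], ⟨by rw [hd, hσeq], pos τ, hseg τ hσle le_rfl, by rw [hd, hτeq]⟩, ?_⟩
  -- under `¬F₁ ∧ ¬F₄`, times with distance in `[n₀, N₀]` are in `[σ, τ]`
  intro hF1 hF4 t ht1 ht2
  have ht1' : n₀ ≤ dn (pos t) := by rw [hd] at ht1; exact_mod_cast ht1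
  have ht2' : dn (pos t) ≤ N₀ := by rw [hd] at ht2; exact_mod_cast ht2
  refine hseg t ?_ ?_
  · by_contra hlt
    apply hF1
    refine ⟨t, σ, by omega, ?_, ?_⟩
    · show (n₀ : ℝ) ≤ dist u (pos t)
      rw [hd]; exact_mod_cast ht1'
    · show dist u (pos σ) ≤ a
      rw [hd, hσeq]
  · by_contra hlt
    apply hF4
    refine ⟨τ, t, by omega, ?_, ?_⟩
    · show (b : ℝ) ≤ dist u (pos τ)
      rw [hd, hτeq]
    · show dist u (pos t) ≤ N₀
      rw [hd]; exact_mod_cast ht2'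

/-! ### Components inside a band avoiding `C*` avoid `Γ` -/

/-- **A vertex set away from `C*`, inside the band `[n₀, N₀]`, misses the sites of `Γ`** (under
`¬F₁ ∧ ¬F₄`, by `crossAt_backbone` (ii)). [folklore] -/
theorem not_mem_vis_of_band {n₁ : Current G} {y : V} {n₃ : Current G} {n₀ N₀ : ℕ} {W : Finset V} {σ : ℕ}
    (hmid : ∀ t, (n₀ : ℝ) ≤ dist u (exploreAt rk n₁ {y} u t).pos → dist u (exploreAt rk n₁ {y} u t).pos ≤ N₀ →
      (exploreAt rk n₁ {y} u t).pos ∈ (restrictTo W (n₁ + n₃)).cluster (exploreAt rk n₁ {y} u σ).pos)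
    {z : V} (hz1 : (n₀ : ℝ) ≤ dist u z) (hz2 : dist u z ≤ N₀)
    (hzC : z ∉ (restrictTo W (n₁ + n₃)).cluster (exploreAt rk n₁ {y} u σ).pos) :
    z ∉ (explore rk n₁ {y} u).vis := by
  intro hv
  rw [explore_eq_exploreAt, mem_vis_exploreAt_iff] at hv
  obtain ⟨t, -, ht⟩ := hv
  have := hmid t (by rw [ht]; exact hz1) (by rw [ht]; exact hz2)
  rw [ht] at this
  exact hzC this

omit [PseudoMetricSpace V] in
/-- **From a connection inside a sub-current avoiding `Γ` to an `avoidGraph`-path**: if the cluster of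
`z` in a current `m₁ ≤ n₁ + n₃` misses the sites of `Γ`, every vertex of it is joined to `z` in
`avoidGraph (n₁+n₃) vis(Γ)`. [folklore] -/
theorem avoidGraph_reachable_of_mem_cluster {n₁ n₃ m₁ : Current G} {y : V} (hle : m₁ ≤ n₁ + n₃) {z : V}
    (havoid : ∀ w ∈ m₁.cluster z, w ∉ (explore rk n₁ {y} u).vis) {w : V} (hw : w ∈ m₁.cluster z) :
    (avoidGraph (n₁ + n₃) (explore rk n₁ {y} u).vis).Reachable z w := by
  rw [mem_cluster_iff] at hw
  obtain ⟨p⟩ := hw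
  suffices key : ∀ (s t : V) (_ : (Percolation.openGraph m₁.traced).Walk s t), s ∈ m₁.cluster z →
      (avoidGraph (n₁ + n₃) (explore rk n₁ {y} u).vis).Reachable s t from key z w p (mem_cluster_self _ _)
  intro s t p
  induction p with
  | nil => exact fun _ => SimpleGraph.Reachable.refl _
  | @cons s s' t h _ ih =>
    intro hs
    have hs' : s' ∈ m₁.cluster z := mem_cluster_of_adj hs h
    refine SimpleGraph.Reachable.trans (SimpleGraph.Adj.reachable ?_) (ih hs')
    refine ⟨?_, havoid s hs, havoid s' hs'⟩
    exact Percolation.openGraph_mono (traced_mono hle) h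

/-! ### Uniqueness of the crossing cluster -/

/-- **Uniqueness** (the events `F₁`, `F₂`, `F₄` rule out a second crossing cluster): under
`¬F₁ ∧ ¬F₂ ∧ ¬F₄`, every crossing cluster of `m = n₁+n₃` in `W` is the canonical cluster `C*` of
`crossAt_backbone`; in particular `UniqueCrossing W a b u (n₁+n₃)`. [cite: AizenmanDuminilCopinAnnals2021, arXiv:1912.07973 §4.2, proof of Lemma 4.4 ("If the event {𝓜 ≠ ∅} occurs but not I_k, then one of the following four events must occur", p. 12)] -/
theorem cluster_eq_canonical_of_not_F (hstep : ∀ v w, G.Adj v w → dist u w ≤ dist u v + 1)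
    (hint : ∀ v, ∃ k : ℕ, dist u v = k) (hrk : Function.Injective rk) {n₁ : Current G} {y : V} (n₃ : Current G)
    {a n₀ m₀ M₀ N₀ b : ℕ} (han : a < n₀) (hnm : n₀ ≤ m₀) (hmM : m₀ ≤ M₀) (hMN : M₀ ≤ N₀) (hNb : N₀ < b)
    (hs : n₁.sources = {u} ∆ {y}) (hy : (b : ℝ) < dist u y) {W : Finset V}
    (hW : ∀ v, v ∈ W ↔ (a : ℝ) ≤ dist u v ∧ dist u v ≤ b)
    (hF1 : ¬ FOne rk n₁ y u n₀ a) (hF2 : ¬ FBand rk n₁ n₃ y u n₀ m₀) (hF4 : ¬ FFour rk n₁ y u b N₀) :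
    ∃ σ : ℕ, CrossAt W a b u (n₁ + n₃) (exploreAt rk n₁ {y} u σ).pos ∧
      (∀ v, CrossAt W a b u (n₁ + n₃) v →
        (restrictTo W (n₁ + n₃)).cluster v = (restrictTo W (n₁ + n₃)).cluster (exploreAt rk n₁ {y} u σ).pos) ∧
      (∀ t, (n₀ : ℝ) ≤ dist u (exploreAt rk n₁ {y} u t).pos → dist u (exploreAt rk n₁ {y} u t).pos ≤ N₀ →
        (exploreAt rk n₁ {y} u t).pos ∈ (restrictTo W (n₁ + n₃)).cluster (exploreAt rk n₁ {y} u σ).pos) := by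
  obtain ⟨σ, hσa, hcross, hmid⟩ := crossAt_backbone (rk := rk) hstep hint hrk n₃ han (hnm.trans (hmM.trans hMN)) hNb hs hy hW
  have hmid' := hmid hF1 hF4
  refine ⟨σ, hcross, fun v hv => ?_, hmid'⟩
  set m := n₁ + n₃ with hm
  set Cstar := (restrictTo W m).cluster (exploreAt rk n₁ {y} u σ).pos with hC
  rcases cluster_eq_or_disjoint (restrictTo W m) v (exploreAt rk n₁ {y} u σ).pos with heq | hdis
  · exact heq
  · -- a second crossing cluster crosses the band `[n₀, m₀]` away from `C*`, hence off `Γ`: `F₂`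
    exfalso
    apply hF2
    obtain ⟨hva, v₁, hv₁, hv₁b⟩ := hv
    -- forced crossing of the band `[n₀, m₀]` by the restricted current `m|_W`, from `v` to `v₁`
    set B : Finset V := univ.filter fun w => (n₀ : ℝ) ≤ dist u w ∧ dist u w ≤ m₀ with hB
    have hBmem : ∀ w, w ∈ B ↔ (n₀ : ℝ) ≤ dist u w ∧ dist u w ≤ m₀ := fun w => by simp [hB]
    obtain ⟨z, hz, hzn, z', hz', hz'm⟩ := exists_crossAt_of_mem_cluster hstep hint hnm hBmem
      (m := restrictTo W m) (s := v) (x := v₁) hv₁ (by rw [hva]; exact_mod_cast han.le)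
      (by rw [hv₁b]; exact_mod_cast (hmM.trans hMN).trans hNb.le)
    -- the band component of `z` lies in the cluster of `v`, away from `C*`, inside the band
    have hzB : z ∈ B := (hBmem z).2 ⟨by rw [hzn], by rw [hzn]; exact_mod_cast hnm⟩
    have havoid : ∀ w ∈ (restrictTo B (restrictTo W m)).cluster z, w ∉ (explore rk n₁ {y} u).vis := by
      intro w hw
      have hwB : w ∈ B := cluster_restrictTo_subset hzB hw
      have hwv : w ∈ (restrictTo W m).cluster v :=
        mem_cluster_trans hz (cluster_mono (restrictTo_le B _) z hw)
      have hwC : w ∉ Cstar := fun h => Finset.disjoint_left.1 hdis hwv h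
      obtain ⟨hw1, hw2⟩ := (hBmem w).1 hwB
      exact not_mem_vis_of_band hmid' hw1 (hw2.trans (by exact_mod_cast hmM.trans hMN)) hwC
    refine ⟨z, z', hzn, hz'm, avoidGraph_reachable_of_mem_cluster (rk := rk) ?_ havoid hz'⟩
    exact (restrictTo_le B _).trans (restrictTo_le W m)

/-- **The intersection sites lie in `C*`** (the events `F₂`, `F₃` rule out the alternative): under
`¬F₂ ∧ ¬F₃` and the conclusion (ii) of `crossAt_backbone` (which holds under `¬F₁ ∧ ¬F₄`), every
`x₀ ∈ C_m(u)` with `m₀ ≤ dist(u,x₀) ≤ M₀` lies in the canonical crossing cluster `C*`. (Its component in `m|_{[n₀,N₀]}` reaches the sphere `n₀` or `N₀` — a path to `u` must leave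
the band; if the component is not inside `C*` it is away from `C*`, hence off `Γ`, and a forced crossing of
`[n₀, m₀]` or `[M₀, N₀]` inside it is `F₂` or `F₃`.) [cite: AizenmanDuminilCopinAnnals2021, arXiv:1912.07973 §4.2, proof of Lemma 4.4 (p. 12, Fig. 3)] -/
theorem mem_canonical_of_not_F (hstep : ∀ v w, G.Adj v w → dist u w ≤ dist u v + 1)
    (hint : ∀ v, ∃ k : ℕ, dist u v = k) {n₁ : Current G} {y : V} (n₃ : Current G)
    {a n₀ m₀ M₀ N₀ b : ℕ} (han : a < n₀) (hnm : n₀ ≤ m₀) (hMN : M₀ ≤ N₀) (hNb : N₀ < b) {W : Finset V}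
    (hW : ∀ v, v ∈ W ↔ (a : ℝ) ≤ dist u v ∧ dist u v ≤ b)
    (hF2 : ¬ FBand rk n₁ n₃ y u n₀ m₀) (hF3 : ¬ FBand rk n₁ n₃ y u M₀ N₀) {σ : ℕ}
    (hmid : ∀ t, (n₀ : ℝ) ≤ dist u (exploreAt rk n₁ {y} u t).pos → dist u (exploreAt rk n₁ {y} u t).pos ≤ N₀ →
      (exploreAt rk n₁ {y} u t).pos ∈ (restrictTo W (n₁ + n₃)).cluster (exploreAt rk n₁ {y} u σ).pos)
    {x₀ : V} (hx₀ : x₀ ∈ (n₁ + n₃).cluster u) (hx1 : (m₀ : ℝ) ≤ dist u x₀) (hx2 : dist u x₀ ≤ M₀) :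
    x₀ ∈ (restrictTo W (n₁ + n₃)).cluster (exploreAt rk n₁ {y} u σ).pos := by
  classical
  set m := n₁ + n₃ with hm
  set Cstar := (restrictTo W m).cluster (exploreAt rk n₁ {y} u σ).pos with hC
  by_contra hx₀C
  -- the band `[n₀, N₀]` and the component `K` of `x₀` in `m|_{band}`
  set B₂ : Finset V := univ.filter fun w => (n₀ : ℝ) ≤ dist u w ∧ dist u w ≤ N₀ with hB₂
  have hB₂mem : ∀ w, w ∈ B₂ ↔ (n₀ : ℝ) ≤ dist u w ∧ dist u w ≤ N₀ := fun w => by simp [hB₂]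
  have hx₀B : x₀ ∈ B₂ := (hB₂mem x₀).2 ⟨le_trans (by exact_mod_cast hnm) hx1, hx2.trans (by exact_mod_cast hMN)⟩
  have hB₂W : B₂ ⊆ W := fun w hw => by
    obtain ⟨h1, h2⟩ := (hB₂mem w).1 hw
    exact (hW w).2 ⟨le_trans (by exact_mod_cast han.le) h1, h2.trans (by exact_mod_cast hNb.le)⟩
  set K := (restrictTo B₂ m).cluster x₀ with hK
  -- `K` avoids `C*`: it lies in the cluster of `x₀` in `m|_W`, which is not `C*`
  have hKW : K ⊆ (restrictTo W m).cluster x₀ := cluster_mono (restrictTo_mono_set hB₂W m) x₀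
  have hdis : Disjoint ((restrictTo W m).cluster x₀) Cstar := by
    rcases cluster_eq_or_disjoint (restrictTo W m) x₀ (exploreAt rk n₁ {y} u σ).pos with h | h
    · exfalso
      apply hx₀C
      rw [hC, ← h]
      exact mem_cluster_self _ x₀
    · exact h
  have havoidK : ∀ w ∈ K, w ∉ (explore rk n₁ {y} u).vis := by
    intro w hw
    obtain ⟨hw1, hw2⟩ := (hB₂mem w).1 (cluster_restrictTo_subset hx₀B hw)
    exact not_mem_vis_of_band hmid hw1 hw2 (fun h => Finset.disjoint_left.1 hdis (hKW hw) h)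
  -- `K` contains a vertex at distance `n₀` or `N₀`: a path to `u` must leave the band
  have hK_exit : ∃ zz ∈ K, dist u zz = n₀ ∨ dist u zz = N₀ := by
    by_contra hno
    push Not at hno
    -- then `K` is closed under the open edges of `m`, and contains `u` — absurd
    have hclosed : ∀ w ∈ K, ∀ w', (Percolation.openGraph m.traced).Adj w w' → w' ∈ K := by
      intro w hw w' hadj
      obtain ⟨hw1, hw2⟩ := (hB₂mem w).1 (cluster_restrictTo_subset hx₀B hw)
      obtain ⟨hne1, hne2⟩ := hno w hw
      have hG := adj_of_adj_traced hadj
      have h1 := hstep w w' hG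
      have h2 := hstep w' w hG.symm
      -- `n₀ < dist w < N₀`, so `dist w' ∈ [n₀, N₀]`
      have hw1' : (n₀ : ℝ) < dist u w := lt_of_le_of_ne hw1 (fun h => hne1 h.symm)
      have hw2' : dist u w < N₀ := lt_of_le_of_ne hw2 hne2
      obtain ⟨kw, hkw⟩ := hint w
      obtain ⟨kw', hkw'⟩ := hint w'
      rw [hkw] at hw1' hw2' h1 h2
      rw [hkw'] at h1 h2
      have hw'B : w' ∈ B₂ := by
        rw [hB₂mem, hkw']
        have e1 : n₀ < kw := by exact_mod_cast hw1'
        have e2 : kw < N₀ := by exact_mod_cast hw2'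
        have e3 : kw' ≤ kw + 1 := by exact_mod_cast h1
        have e4 : kw ≤ kw' + 1 := by exact_mod_cast h2
        exact ⟨by exact_mod_cast (show n₀ ≤ kw' by omega), by exact_mod_cast (show kw' ≤ N₀ by omega)⟩
      exact mem_cluster_of_adj hw (adj_restrictTo_iff.2 ⟨hadj, cluster_restrictTo_subset hx₀B hw, hw'B⟩)
    have hreach : ∀ (s t : V) (_ : (Percolation.openGraph m.traced).Walk s t), s ∈ K → t ∈ K := by
      intro s t p
      induction p with
      | nil => exact id
      | cons h _ ih => exact fun hs' => ih (hclosed _ hs' _ h)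
    have huK : u ∈ K := by
      have hxu : u ∈ m.cluster x₀ := (mem_cluster_comm).1 hx₀
      rw [mem_cluster_iff] at hxu
      obtain ⟨p⟩ := hxu
      exact hreach x₀ u p (mem_cluster_self _ x₀)
    have := ((hB₂mem u).1 (cluster_restrictTo_subset hx₀B huK)).1
    rw [dist_self] at this
    have : n₀ = 0 := by exact_mod_cast le_antisymm (by exact_mod_cast this) (Nat.zero_le n₀)
    omega
  obtain ⟨zz, hzzK, hzz⟩ := hK_exit
  rcases hzz with hzz | hzz
  · -- a forced crossing of `[n₀, m₀]` inside `K`, from `zz` to `x₀`: `F₂`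
    apply hF2
    set B : Finset V := univ.filter fun w => (n₀ : ℝ) ≤ dist u w ∧ dist u w ≤ m₀ with hB
    have hBmem : ∀ w, w ∈ B ↔ (n₀ : ℝ) ≤ dist u w ∧ dist u w ≤ m₀ := fun w => by simp [hB]
    have hx₀zz : x₀ ∈ (restrictTo B₂ m).cluster zz := (mem_cluster_comm).1 hzzK
    obtain ⟨z, hz, hzn, z', hz', hz'm⟩ := exists_crossAt_of_mem_cluster hstep hint hnm hBmem
      (m := restrictTo B₂ m) (s := zz) (x := x₀) hx₀zz (by rw [hzz]) hx1
    have hzB : z ∈ B := (hBmem z).2 ⟨by rw [hzn], by rw [hzn]; exact_mod_cast hnm⟩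
    have hsub : (restrictTo B (restrictTo B₂ m)).cluster z ⊆ K := fun w hw =>
      mem_cluster_trans hzzK (mem_cluster_trans hz (cluster_mono (restrictTo_le B _) z hw))
    refine ⟨z, z', hzn, hz'm, avoidGraph_reachable_of_mem_cluster (rk := rk) ?_ (fun w hw => havoidK w (hsub hw)) hz'⟩
    exact (restrictTo_le B _).trans (restrictTo_le B₂ m)
  · -- a forced crossing of `[M₀, N₀]` inside `K`, from `x₀` to `zz`: `F₃`
    apply hF3
    set B : Finset V := univ.filter fun w => (M₀ : ℝ) ≤ dist u w ∧ dist u w ≤ N₀ with hB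
    have hBmem : ∀ w, w ∈ B ↔ (M₀ : ℝ) ≤ dist u w ∧ dist u w ≤ N₀ := fun w => by simp [hB]
    obtain ⟨z, hz, hzn, z', hz', hz'm⟩ := exists_crossAt_of_mem_cluster hstep hint hMN hBmem
      (m := restrictTo B₂ m) (s := x₀) (x := zz) hzzK hx2 (by rw [hzz])
    have hzB : z ∈ B := (hBmem z).2 ⟨by rw [hzn], by rw [hzn]; exact_mod_cast hMN⟩
    have hsub : (restrictTo B (restrictTo B₂ m)).cluster z ⊆ K := fun w hw =>
      mem_cluster_trans hz (cluster_mono (restrictTo_le B _) z hw)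
    refine ⟨z, z', hzn, hz'm, avoidGraph_reachable_of_mem_cluster (rk := rk) ?_ (fun w hw => havoidK w (hsub hw)) hz'⟩
    exact (restrictTo_le B _).trans (restrictTo_le B₂ m)

/-- **The geometric core of the intersection property** (Aizenman–Duminil-Copin 2021, proof of Lemma 4.4:
"If the event `{𝓜 ≠ ∅}` occurs but not `I_k`, then one of the following four events must occur …",
applied to both pairs of currents). For the pairs `(n₁, n₃)` and `(n₂, n₄)` with `∂n₁ = ∂n₂ = {u} Δ {y}`,
`dist(u,y) > b`, radii `a < n₀ ≤ m₀ ≤ M₀ ≤ N₀ < b`: if none of `F₁, F₂, F₃, F₄` occurs for `(n₁,n₃)` nor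
for `(n₂,n₄)`, and some site of `C_{n₁+n₃}(u) ∩ C_{n₂+n₄}(u)` has distance in `[m₀, M₀]` (`𝓜 ≠ ∅`), then
`I_k` holds: `IkEvent W a b u (n₁+n₃) (n₂+n₄)`. [cite: AizenmanDuminilCopinAnnals2021, arXiv:1912.07973 §4.2, proof of Lemma 4.4 (p. 12); §6.1, proof of Lemma 6.2 (p. 21)] -/
theorem ikEvent_of_not_F (hstep : ∀ v w, G.Adj v w → dist u w ≤ dist u v + 1)
    (hint : ∀ v, ∃ k : ℕ, dist u v = k) (hrk : Function.Injective rk) {n₁ n₂ : Current G} {y : V} (n₃ n₄ : Current G)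
    {a n₀ m₀ M₀ N₀ b : ℕ} (han : a < n₀) (hnm : n₀ ≤ m₀) (hmM : m₀ ≤ M₀) (hMN : M₀ ≤ N₀) (hNb : N₀ < b)
    (hs₁ : n₁.sources = {u} ∆ {y}) (hs₂ : n₂.sources = {u} ∆ {y}) (hy : (b : ℝ) < dist u y) {W : Finset V}
    (hW : ∀ v, v ∈ W ↔ (a : ℝ) ≤ dist u v ∧ dist u v ≤ b)
    (hF1 : ¬ FOne rk n₁ y u n₀ a) (hF2 : ¬ FBand rk n₁ n₃ y u n₀ m₀) (hF3 : ¬ FBand rk n₁ n₃ y u M₀ N₀)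
    (hF4 : ¬ FFour rk n₁ y u b N₀)
    (hF1' : ¬ FOne rk n₂ y u n₀ a) (hF2' : ¬ FBand rk n₂ n₄ y u n₀ m₀) (hF3' : ¬ FBand rk n₂ n₄ y u M₀ N₀)
    (hF4' : ¬ FFour rk n₂ y u b N₀)
    {x₀ : V} (hx₀ : x₀ ∈ (n₁ + n₃).cluster u) (hx₀' : x₀ ∈ (n₂ + n₄).cluster u)
    (hx1 : (m₀ : ℝ) ≤ dist u x₀) (hx2 : dist u x₀ ≤ M₀) :
    IkEvent W a b u (n₁ + n₃) (n₂ + n₄) := by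
  obtain ⟨σ, hc, huniq, hmid⟩ := cluster_eq_canonical_of_not_F hstep hint hrk n₃ han hnm hmM hMN hNb hs₁ hy hW hF1 hF2 hF4
  obtain ⟨σ', hc', huniq', hmid'⟩ := cluster_eq_canonical_of_not_F hstep hint hrk n₄ han hnm hmM hMN hNb hs₂ hy hW hF1' hF2' hF4'
  have hxC := mem_canonical_of_not_F hstep hint n₃ han hnm hMN hNb hW hF2 hF3 hmid hx₀ hx1 hx2
  have hxC' := mem_canonical_of_not_F hstep hint n₄ han hnm hMN hNb hW hF2' hF3' hmid' hx₀' hx1 hx2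
  refine ⟨fun v v' hv hv' => by rw [huniq v hv, huniq v' hv'], fun v v' hv hv' => by rw [huniq' v hv, huniq' v' hv'],
    _, _, hc, hc', x₀, mem_inter.2 ⟨hxC, hxC'⟩⟩

end Setting

end Current

end Literature.Probability.LatticeModels
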